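import Literature.NumberTheory.Rogawski1990.ArchExplicitTransferFactorCayleyTorus   -- ★ LH3-p04 (g2): `Δ″ = K_ρ·τ·D` on the Cayley family, Laurent form under `hμω`; brings ★ (W1-cont) bookkeeping
import Literature.NumberTheory.Rogawski1990.ArchTorusOrbitalAnglesSmooth            -- ★ LH3-p04 (g2): `contDiff_integral_comp_conj_archDiagTorus_angles_of_compactSpace`
import Literature.NumberTheory.Automorphic.ArchTorusOrbitalWeyl                     -- ★ `isConj_archDiagTorus_comp_perm` (admissible relabellings are conjugate — all of them at a definite frame)
import HarnessLib

/-!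
# (D-i-def) The Δ″-side `φ^H` on the compact Cartan is `C^∞` IN THE ANGLES ACROSS THE `G`-WALLS at a TOTALLY DEFINITE frame
# (Rogawski 1990 §8.2 p. 119, §4.9, §14.6; Shelstad 1979 §4)

Topic `NumberTheory/Rogawski1990`; namespace `Literature.NumberTheory.Rogawski1990`.  THEOREMS ONLY (no `def`, no instance, no notation, no axiom, no named fact, no `sorry`).
Cell `pub/hodgecm-mathlib`, line LH3 (closer stub `stub_N9`, crux H413 = `stmt-HodgeConjecture-24833`), organ **(D-i-def)** of LH3-plan (g2)'s DEALER WORDS #3 = D2-SPEC §4 (I₂)-row «definite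
places termwise» = MEMO-N9-direct-road.v1 §1 (M2) in its only easy case: at a definite place every root of `G′_w = U(3)` is compact, the stable class of `t(z)` is ONE class, no
cancellation between partners is available, and Shelstad's «`φ^H ∈ C^∞(H_reg)`» forces the single term `Δ″(γ_H(z), t(z))·∫_{G′_∞} a′(g·t(z)·g⁻¹) dν′` to be smooth through the `G`-walls
`z_{w,1} ∈ {z_{w,0}, z_{w,2}}`.  It IS — by the μ-guard: ★ `exists_archExplicitDelta_cayleyTorus_relabel_eq_prod` makes `Δ″` a Laurent polynomial in the circle coordinates, and ★
`contDiff_integral_comp_conj_archDiagTorus_angles_of_compactSpace` makes the orbital factor smooth everywhere on the compact group.  Author LH3-p04 (g2), 2026-09-02.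

THE FRAME.  `G′_∞ = U(diag α)(L⁺ ⊗ ℝ)` with `re σ_w(α_i)` of ONE sign at each place (`hsame`; every relabelling is then admissible, ★ `isConj_archDiagTorus_comp_perm`), hence compact (the
instance `[CompactSpace G′_∞]` is taken as a binder — the consumer's frame supplies it); the Cayley-frame family `γ_H(z)` of ★ (W1-cont) under its equality binder `hγH`; `ν′` finite on compacts
and right-invariant; the angle chart `θ ↦ ζe^{iθ}` (`ζ, θ : W → Fin 3 → …`).

WHAT IS PROVED.
* §1 **`finsum_transferFactor_delta_mul_integral_eq_single_of_sameSign`** — ONE CLASS: for any ★ `ArchTransferFactor T` and every `z` (walls included),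
  `Σᶠ_{c′} T.Δ(γ_H(z), out c′)·∫ a′(g·out c′·g⁻¹) dν′ = T.Δ(γ_H(z), t(z))·∫ a′(g·t(z)·g⁻¹) dν′` (every matching class is `⟦t(z∘ρ)⟧ = ⟦t(z)⟧`; `T.Δ`, the Haar orbital integral are class functions).
* §2 `contDiff_archExplicitDelta_cayleyTorus_angles` — under `hμω`, `θ ↦ Δ″(γ_H(ζe^{iθ}), t(ζe^{iθ}))` is `ContDiff ℝ ∞` on ALL of angle space (any signature: the Laurent form of ★
  `exists_archExplicitDelta_cayleyTorus_relabel_eq_prod` at `ρ = 1`).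
* §3 **`contDiff_finsum_archExplicitDelta_mul_integral_angles_of_sameSign`** — THE HEAD (D-i-def): under `hμω`, `[CompactSpace G′_∞]`, `hsame`, for an ambient-smooth `a′ = Θ ∘ ↑↑`,
  `θ ↦ Σᶠ_{c′} Δ″(γ_H(ζe^{iθ}), out c′)·∫_{G′_∞} Θ(↑↑(g·out c′·g⁻¹)) dν′` is `ContDiff ℝ ∞` EVERYWHERE (no regularity hypothesis: through the `G`-walls AND the `H`-walls of the chart);
  `…_of_archSmooth` for `a′ ∈ C_c^∞(G′_∞)` (★ `ArchSmooth.exists_contDiff`).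
HONEST LABEL: HC_CM is proved only modulo the 7 printed citations (2 remaining: hLiu418 = stmt-HodgeConjecture-24832, h413 = stmt-HodgeConjecture-24833) until rung 0 closes; this is the
(I₂)-row «definite places termwise» of organ (M2) of the LH3 direct road in Haar∕torus currency and pays nothing by itself (for `[L⁺:ℚ] = 1` the totally definite slice is the whole
frame of `stub_N9`'s inner form; the m′-currency reading waits on the (CUR) organ).

## References
* [Rogawski1990] J. D. Rogawski, *Automorphic Representations of Unitary Groups in Three Variables*, Ann. of Math. Stud. 123 (1990), §8.2 p. 119, §4.9 p. 55, §14.2 p. 232, §14.6 p. 242.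
* [Shelstad1979] D. Shelstad, *Characters and inner forms of a quasi-split group over `ℝ`*, Compositio Math. 39 (1979), §4.
* [LanglandsShelstad1987] R. P. Langlands, D. Shelstad, *On the definition of transfer factors*, Math. Ann. 278 (1987), Lemma 4.1.A.
-/

set_option autoImplicit false

noncomputable section

open NumberField NumberField.InfinitePlace NumberField.mixedEmbedding Filter Topology Complex Equiv MeasureTheory
open scoped MatrixGroups ContDiff Classical
open scoped Matrix.Norms.Operator

namespace Literature.NumberTheory.Rogawski1990

open Literature.NumberTheory.Automorphic Literature.NumberTheory.Automorphic.UnitaryGroup Literature.NumberTheory.GaloisRepresentations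

section Definite

variable (L : Type) [Field L] [NumberField L] [IsCMField L] (α : Fin 3 → L)
  (γH : ({w : InfinitePlace L // IsComplex w} → Fin 3 → Circle) →
    ↥(UnitaryGroup.arch (↥(maximalRealSubfield L)) L (IsCMField.complexConj L) 2
        (Matrix.of fun i j : Fin 2 => if i.val + j.val + 1 = 2 then (1 : L) else 0)) ×
      ↥(UnitaryGroup.arch (↥(maximalRealSubfield L)) L (IsCMField.complexConj L) 1
        (Matrix.of fun i j : Fin 1 => if i.val + j.val + 1 = 1 then (1 : L) else 0)))
  (hγH : γH = fun z =>
    ((UnitaryGroup.archPiEquivCM 2 L (Matrix.of fun i j : Fin 2 => if i.val + j.val + 1 = 2 then (1 : L) else 0)).symm fun w =>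
        ⟨Matrix.GeneralLinearGroup.mkOfDetNeZero !![(1 : ℂ), 1; 1, -1] UnitaryGroup.det_cayleyTwo_ne_zero *
            UnitaryGroup.circleDiagonal 2 ![z w 0, z w 2] *
          (Matrix.GeneralLinearGroup.mkOfDetNeZero !![(1 : ℂ), 1; 1, -1] UnitaryGroup.det_cayleyTwo_ne_zero)⁻¹,
          UnitaryGroup.cayley_conj_circleDiagonal_mem_archLocal L w _⟩,
      (UnitaryGroup.archPiEquivCM 1 L (Matrix.of fun i j : Fin 1 => if i.val + j.val + 1 = 1 then (1 : L) else 0)).symm fun w =>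
        ⟨UnitaryGroup.circleDiagonal 1 ![z w 1], UnitaryGroup.circleDiagonal_mem_archLocal_antidiagOne L w _⟩))
  [MeasurableSpace ↥(UnitaryGroup.arch (↥(maximalRealSubfield L)) L (IsCMField.complexConj L) 3 (Matrix.diagonal α))]
  [BorelSpace ↥(UnitaryGroup.arch (↥(maximalRealSubfield L)) L (IsCMField.complexConj L) 3 (Matrix.diagonal α))]
  (ν' : Measure ↥(UnitaryGroup.arch (↥(maximalRealSubfield L)) L (IsCMField.complexConj L) 3 (Matrix.diagonal α))) [ν'.IsMulRightInvariant]

/-! ## §1 One class: the `Δ`-side is a single term at a frame where every relabelling is admissible -/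

include hγH in
/-- **ONE CLASS ⇒ ONE TERM**: if at every place all `re σ_w(α_i)` have the same sign (totally definite frame), then for every archimedean transfer factor `T`, every right-invariant `ν′`,
every `a′` and EVERY `z` (walls included), `Σᶠ_{c′} T.Δ(γ_H(z), out c′)·∫ a′(g·out c′·g⁻¹) dν′ = T.Δ(γ_H(z), t(z))·∫ a′(g·t(z)·g⁻¹) dν′`: a class carrying `T.Δ ≠ 0` matches `ι(γ_H(z))`, hence is some
`⟦t(z∘ρ)⟧` (★ `support_transferFactor_delta_mul_subset_image_relabel`), and `t(z∘ρ) ∼ t(z)` for every `ρ` (★ `isConj_archDiagTorus_comp_perm`, all relabellings admissible); `T.Δ(γ_H, ·)` and the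
Haar orbital integral are class functions. [cite: Rogawski1990, §14.2 p. 232; §4.3 p. 43] -/
theorem finsum_transferFactor_delta_mul_integral_eq_single_of_sameSign (hα : ∀ i, α i ≠ 0) (hherm : ∀ i, (IsCMField.complexConj L (α i) : L) = α i)
    (hsame : ∀ (w : {w : InfinitePlace L // IsComplex w}) (i j : Fin 3), (0 < (w.1.embedding (α i)).re ↔ 0 < (w.1.embedding (α j)).re))
    (T : ArchTransferFactor L (Matrix.diagonal α))
    (a' : ↥(UnitaryGroup.arch (↥(maximalRealSubfield L)) L (IsCMField.complexConj L) 3 (Matrix.diagonal α)) → ℂ)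
    (z : {w : InfinitePlace L // IsComplex w} → Fin 3 → Circle) :
    ∑ᶠ c' : ConjClasses ↥(UnitaryGroup.arch (↥(maximalRealSubfield L)) L (IsCMField.complexConj L) 3 (Matrix.diagonal α)),
        T.Δ (γH z) (Quotient.out c') * ∫ g, a' (g * Quotient.out c' * g⁻¹) ∂ν' =
      T.Δ (γH z) (UnitaryGroup.archDiagTorus L 3 α z) * ∫ g, a' (g * UnitaryGroup.archDiagTorus L 3 α z * g⁻¹) ∂ν' := by
  -- every relabelled torus point is conjugate to `t(z)`
  have hconj : ∀ ρ : {w : InfinitePlace L // IsComplex w} → Perm (Fin 3),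
      ConjClasses.mk (UnitaryGroup.archDiagTorus L 3 α fun w => z w ∘ ρ w) = ConjClasses.mk (UnitaryGroup.archDiagTorus L 3 α z) := fun ρ =>
    ConjClasses.mk_eq_mk_iff_isConj.mpr (UnitaryGroup.isConj_archDiagTorus_comp_perm L 3 α hα hherm (fun w i => hsame w (ρ w i) i) z).symm
  rw [finsum_eq_single _ (ConjClasses.mk (UnitaryGroup.archDiagTorus L 3 α z))]
  · rw [transferFactor_delta_out_mk, integral_comp_conj_out_mk]
  · intro c' hc'
    by_contra hne
    have hmem := support_transferFactor_delta_mul_subset_image_relabel L α γH hγH T hα hherm (fun c => ∫ g, a' (g * Quotient.out c * g⁻¹) ∂ν') z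
      (Function.mem_support.mpr hne)
    rw [Finset.coe_image, Finset.coe_univ, Set.image_univ] at hmem
    obtain ⟨ρ, hρ⟩ := hmem
    exact hc' (hρ.symm.trans (hconj ρ))

/-! ## §2 The `Δ″`-factor along the angle chart is smooth everywhere (any signature) -/

omit [IsCMField L] [MeasurableSpace ↥(UnitaryGroup.arch (↥(maximalRealSubfield L)) L (IsCMField.complexConj L) 3 (Matrix.diagonal α))]
  [BorelSpace ↥(UnitaryGroup.arch (↥(maximalRealSubfield L)) L (IsCMField.complexConj L) 3 (Matrix.diagonal α))] in
/-- A circle coordinate of the angle chart, read in `ℂ`, is smooth in the angles and never zero: `θ ↦ ζ_{w,i}·e^{iθ_{w,i}}`. [cite: Rogawski1990, §8.4 p. 126] -/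
private theorem contDiff_coe_chart (ζ : {w : InfinitePlace L // IsComplex w} → Fin 3 → Circle) (w : {w : InfinitePlace L // IsComplex w}) (i : Fin 3) :
    ContDiff ℝ ∞ fun θ : {w : InfinitePlace L // IsComplex w} → Fin 3 → ℝ => ((ζ w i * Circle.exp (θ w i) : Circle) : ℂ) := by
  have h : (fun θ : {w : InfinitePlace L // IsComplex w} → Fin 3 → ℝ => ((ζ w i * Circle.exp (θ w i) : Circle) : ℂ)) =
      fun θ => (ζ w i : ℂ) * Complex.exp ((θ w i : ℂ) * Complex.I) := by
    funext θ; rw [Circle.coe_mul, Circle.coe_exp]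
  rw [h]
  exact contDiff_const.mul (Complex.contDiff_exp.comp
    ((Complex.ofRealCLM.contDiff.comp ((contDiff_apply ℝ ℝ i).comp (contDiff_apply ℝ (Fin 3 → ℝ) w))).mul contDiff_const))

include hγH in
omit [MeasurableSpace ↥(UnitaryGroup.arch (↥(maximalRealSubfield L)) L (IsCMField.complexConj L) 3 (Matrix.diagonal α))]
  [BorelSpace ↥(UnitaryGroup.arch (↥(maximalRealSubfield L)) L (IsCMField.complexConj L) 3 (Matrix.diagonal α))] in
/-- **THE `Δ″`-FACTOR IS `C^∞` IN THE ANGLES EVERYWHERE** (any signature, under the μ-guard): along the chart `θ ↦ ζe^{iθ}`, `θ ↦ Δ″(γ_H(ζe^{iθ}), t(ζe^{iθ}))` is a constant times the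
Laurent polynomial of ★ `exists_archExplicitDelta_cayleyTorus_relabel_eq_prod` (`ρ = 1`), whose atoms `ζ_{w,i}e^{iθ_{w,i}}` are smooth and non-zero. [cite: Rogawski1990, §8.2 p. 119; §4.9 p. 55] -/
theorem contDiff_archExplicitDelta_cayleyTorus_angles (μ : HeckeCharacter L)
    (hμω : ∀ x : ideleGroup ↥(maximalRealSubfield L), μ (AdeleRing.ideleBaseChange (↥(maximalRealSubfield L)) L x) = quadraticHeckeCharCM L x)
    (ζ : {w : InfinitePlace L // IsComplex w} → Fin 3 → Circle) :
    ContDiff ℝ ∞ fun θ : {w : InfinitePlace L // IsComplex w} → Fin 3 → ℝ =>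
      archExplicitDelta L (Matrix.diagonal α) (γH fun w i => ζ w i * Circle.exp (θ w i)) μ
        (UnitaryGroup.archDiagTorus L 3 α fun w i => ζ w i * Circle.exp (θ w i)) := by
  obtain ⟨k, hk⟩ := exists_archExplicitDelta_cayleyTorus_relabel_eq_prod L α γH hγH μ hμω
  have hfun : (fun θ : {w : InfinitePlace L // IsComplex w} → Fin 3 → ℝ =>
      archExplicitDelta L (Matrix.diagonal α) (γH fun w i => ζ w i * Circle.exp (θ w i)) μ (UnitaryGroup.archDiagTorus L 3 α fun w i => ζ w i * Circle.exp (θ w i))) =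
      fun θ => ((∏ w : {w : InfinitePlace L // IsComplex w}, ((SignType.sign ((w.1.embedding (α (((1 : {w : InfinitePlace L // IsComplex w} → Perm (Fin 3)) w).symm 1))).re) : ℤ) *
          archMajoritySign L (Matrix.diagonal α) w) : ℤ) : ℂ) *
        ∏ w : {w : InfinitePlace L // IsComplex w},
          -(((((ζ w 0 * Circle.exp (θ w 0) : Circle) : ℂ) * ((ζ w 2 * Circle.exp (θ w 2) : Circle) : ℂ)) ^ (k w)) *
              ((((ζ w 1 * Circle.exp (θ w 1) : Circle) : ℂ) - ((ζ w 0 * Circle.exp (θ w 0) : Circle) : ℂ)) *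
                (((ζ w 1 * Circle.exp (θ w 1) : Circle) : ℂ) - ((ζ w 2 * Circle.exp (θ w 2) : Circle) : ℂ))) / ((ζ w 1 * Circle.exp (θ w 1) : Circle) : ℂ)) := by
    funext θ
    exact hk (fun w i => ζ w i * Circle.exp (θ w i)) 1
  rw [hfun]
  refine contDiff_const.mul (contDiff_prod fun w _ => ?_)
  have h0 := contDiff_coe_chart L ζ w 0
  have h1 := contDiff_coe_chart L ζ w 1
  have h2 := contDiff_coe_chart L ζ w 2
  have hzpow : ContDiff ℝ ∞ fun θ : {w : InfinitePlace L // IsComplex w} → Fin 3 → ℝ =>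
      (((ζ w 0 * Circle.exp (θ w 0) : Circle) : ℂ) * ((ζ w 2 * Circle.exp (θ w 2) : Circle) : ℂ)) ^ (k w) := by
    refine contDiff_iff_contDiffAt.2 fun θ => ?_
    have hne : ((ζ w 0 * Circle.exp (θ w 0) : Circle) : ℂ) * ((ζ w 2 * Circle.exp (θ w 2) : Circle) : ℂ) ≠ 0 :=
      mul_ne_zero (Circle.coe_ne_zero _) (Circle.coe_ne_zero _)
    exact (((analyticAt_id (𝕜 := ℂ)).zpow hne).contDiffAt.restrict_scalars ℝ).comp θ (h0.mul h2).contDiffAt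
  simp only [div_eq_mul_inv]
  exact ((hzpow.mul ((h1.sub h0).mul (h1.sub h2))).mul (h1.inv fun θ => Circle.coe_ne_zero _)).neg

/-! ## §3 The head: the `Δ`-side is `C^∞` in the angles everywhere at a totally definite frame -/

include hγH in
/-- **(D-i-def) THE `Δ`-SIDE ON THE COMPACT CARTAN IS `C^∞` IN THE ANGLES ACROSS THE `G`-WALLS AT A TOTALLY DEFINITE FRAME**: for `G′_∞` compact with `re σ_w(α_i)` of one sign at each place,
`ν′` finite on compacts and right-invariant, `Θ` smooth on `M₃(L ⊗ ℝ)` and the μ-guard `hμω`, the function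
`θ ↦ Σᶠ_{c′} Δ″_∞(γ_H(ζe^{iθ}), out c′) · ∫_{G′_∞} Θ(↑↑(g·out c′·g⁻¹)) dν′(g)` is `ContDiff ℝ ∞` on the whole angle space — one class (§1), a Laurent-polynomial `Δ″`-factor (§2) and a
smooth orbital factor (★ `contDiff_integral_comp_conj_archDiagTorus_angles_of_compactSpace`).  This is the (I₂)-row «definite places termwise» of (M2): no cancellation is available and none
is needed. [cite: Rogawski1990, §8.2 p. 119; §14.2 p. 232] [cite: Shelstad1979, §4] [cite: LanglandsShelstad1987, Lemma 4.1.A] -/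
theorem contDiff_finsum_archExplicitDelta_mul_integral_angles_of_sameSign [CompactSpace ↥(UnitaryGroup.arch (↥(maximalRealSubfield L)) L (IsCMField.complexConj L) 3 (Matrix.diagonal α))]
    [IsFiniteMeasureOnCompacts ν'] (hα : ∀ i, α i ≠ 0) (hherm : ∀ i, (IsCMField.complexConj L (α i) : L) = α i)
    (hsame : ∀ (w : {w : InfinitePlace L // IsComplex w}) (i j : Fin 3), (0 < (w.1.embedding (α i)).re ↔ 0 < (w.1.embedding (α j)).re))
    (μ : HeckeCharacter L)
    (hμω : ∀ x : ideleGroup ↥(maximalRealSubfield L), μ (AdeleRing.ideleBaseChange (↥(maximalRealSubfield L)) L x) = quadraticHeckeCharCM L x)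
    (hl : ∀ (a : ↥(UnitaryGroup.arch (↥(maximalRealSubfield L)) L (IsCMField.complexConj L) 2
            (Matrix.of fun i j : Fin 2 => if i.val + j.val + 1 = 2 then (1 : L) else 0)) ×
          ↥(UnitaryGroup.arch (↥(maximalRealSubfield L)) L (IsCMField.complexConj L) 1
            (Matrix.of fun i j : Fin 1 => if i.val + j.val + 1 = 1 then (1 : L) else 0)))
        (b : ↥(UnitaryGroup.arch (↥(maximalRealSubfield L)) L (IsCMField.complexConj L) 3 (Matrix.diagonal α)))
        (x : ↥(UnitaryGroup.arch (↥(maximalRealSubfield L)) L (IsCMField.complexConj L) 2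
            (Matrix.of fun i j : Fin 2 => if i.val + j.val + 1 = 2 then (1 : L) else 0)) ×
          ↥(UnitaryGroup.arch (↥(maximalRealSubfield L)) L (IsCMField.complexConj L) 1
            (Matrix.of fun i j : Fin 1 => if i.val + j.val + 1 = 1 then (1 : L) else 0))),
        archExplicitDelta L (Matrix.diagonal α) (x * a * x⁻¹) μ b = archExplicitDelta L (Matrix.diagonal α) a μ b)
    (hr : ∀ (a : ↥(UnitaryGroup.arch (↥(maximalRealSubfield L)) L (IsCMField.complexConj L) 2
            (Matrix.of fun i j : Fin 2 => if i.val + j.val + 1 = 2 then (1 : L) else 0)) ×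
          ↥(UnitaryGroup.arch (↥(maximalRealSubfield L)) L (IsCMField.complexConj L) 1
            (Matrix.of fun i j : Fin 1 => if i.val + j.val + 1 = 1 then (1 : L) else 0)))
        (b y : ↥(UnitaryGroup.arch (↥(maximalRealSubfield L)) L (IsCMField.complexConj L) 3 (Matrix.diagonal α))),
        archExplicitDelta L (Matrix.diagonal α) a μ (y * b * y⁻¹) = archExplicitDelta L (Matrix.diagonal α) a μ b)
    (Θ : Matrix (Fin 3) (Fin 3) (mixedSpace L) → ℂ) (hΘ : ContDiff ℝ ∞ Θ) (ζ : {w : InfinitePlace L // IsComplex w} → Fin 3 → Circle) :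
    ContDiff ℝ ∞ fun θ : {w : InfinitePlace L // IsComplex w} → Fin 3 → ℝ =>
      ∑ᶠ c' : ConjClasses ↥(UnitaryGroup.arch (↥(maximalRealSubfield L)) L (IsCMField.complexConj L) 3 (Matrix.diagonal α)),
        (archExplicitTransferFactor L (Matrix.diagonal α) μ hl hr).Δ (γH fun w i => ζ w i * Circle.exp (θ w i)) (Quotient.out c') *
          ∫ g : ↥(UnitaryGroup.arch (↥(maximalRealSubfield L)) L (IsCMField.complexConj L) 3 (Matrix.diagonal α)),
            Θ ((((g * Quotient.out c' * g⁻¹ : ↥(UnitaryGroup.arch (↥(maximalRealSubfield L)) L (IsCMField.complexConj L) 3 (Matrix.diagonal α))) :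
              GL (Fin 3) (mixedSpace L)) : Matrix (Fin 3) (Fin 3) (mixedSpace L))) ∂ν' := by
  have hfun : (fun θ : {w : InfinitePlace L // IsComplex w} → Fin 3 → ℝ =>
      ∑ᶠ c' : ConjClasses ↥(UnitaryGroup.arch (↥(maximalRealSubfield L)) L (IsCMField.complexConj L) 3 (Matrix.diagonal α)),
        (archExplicitTransferFactor L (Matrix.diagonal α) μ hl hr).Δ (γH fun w i => ζ w i * Circle.exp (θ w i)) (Quotient.out c') *
          ∫ g : ↥(UnitaryGroup.arch (↥(maximalRealSubfield L)) L (IsCMField.complexConj L) 3 (Matrix.diagonal α)),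
            Θ ((((g * Quotient.out c' * g⁻¹ : ↥(UnitaryGroup.arch (↥(maximalRealSubfield L)) L (IsCMField.complexConj L) 3 (Matrix.diagonal α))) :
              GL (Fin 3) (mixedSpace L)) : Matrix (Fin 3) (Fin 3) (mixedSpace L))) ∂ν') =
      fun θ => archExplicitDelta L (Matrix.diagonal α) (γH fun w i => ζ w i * Circle.exp (θ w i)) μ (UnitaryGroup.archDiagTorus L 3 α fun w i => ζ w i * Circle.exp (θ w i)) *
        ∫ g : ↥(UnitaryGroup.arch (↥(maximalRealSubfield L)) L (IsCMField.complexConj L) 3 (Matrix.diagonal α)),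
          Θ ((((g * UnitaryGroup.archDiagTorus L 3 α (fun w i => ζ w i * Circle.exp (θ w i)) * g⁻¹ :
            ↥(UnitaryGroup.arch (↥(maximalRealSubfield L)) L (IsCMField.complexConj L) 3 (Matrix.diagonal α))) : GL (Fin 3) (mixedSpace L)) : Matrix (Fin 3) (Fin 3) (mixedSpace L))) ∂ν' := by
    funext θ
    exact finsum_transferFactor_delta_mul_integral_eq_single_of_sameSign L α γH hγH ν' hα hherm hsame (archExplicitTransferFactor L (Matrix.diagonal α) μ hl hr)
      (fun g => Θ (((g : GL (Fin 3) (mixedSpace L)) : Matrix (Fin 3) (Fin 3) (mixedSpace L)))) _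
  rw [hfun]
  exact (contDiff_archExplicitDelta_cayleyTorus_angles L α γH hγH μ hμω ζ).mul
    (UnitaryGroup.contDiff_integral_comp_conj_archDiagTorus_angles_of_compactSpace L 3 α ν' Θ hΘ ζ)

include hγH in
/-- **(D-i-def) for a letter-currency test function `a′ ∈ C_c^∞(G′_∞)`** (★ `ArchSmooth.exists_contDiff`: `a′ = Θ ∘ ↑↑` with `Θ` ambient smooth). [cite: Rogawski1990, §14.2 p. 233; §8.2 p. 119]
[cite: Shelstad1979, §4] -/
theorem contDiff_finsum_archExplicitDelta_mul_integral_angles_of_sameSign_of_archSmooth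
    [CompactSpace ↥(UnitaryGroup.arch (↥(maximalRealSubfield L)) L (IsCMField.complexConj L) 3 (Matrix.diagonal α))]
    [IsFiniteMeasureOnCompacts ν'] (hα : ∀ i, α i ≠ 0) (hherm : ∀ i, (IsCMField.complexConj L (α i) : L) = α i)
    (hsame : ∀ (w : {w : InfinitePlace L // IsComplex w}) (i j : Fin 3), (0 < (w.1.embedding (α i)).re ↔ 0 < (w.1.embedding (α j)).re))
    (μ : HeckeCharacter L)
    (hμω : ∀ x : ideleGroup ↥(maximalRealSubfield L), μ (AdeleRing.ideleBaseChange (↥(maximalRealSubfield L)) L x) = quadraticHeckeCharCM L x)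
    (hl : ∀ (a : ↥(UnitaryGroup.arch (↥(maximalRealSubfield L)) L (IsCMField.complexConj L) 2
            (Matrix.of fun i j : Fin 2 => if i.val + j.val + 1 = 2 then (1 : L) else 0)) ×
          ↥(UnitaryGroup.arch (↥(maximalRealSubfield L)) L (IsCMField.complexConj L) 1
            (Matrix.of fun i j : Fin 1 => if i.val + j.val + 1 = 1 then (1 : L) else 0)))
        (b : ↥(UnitaryGroup.arch (↥(maximalRealSubfield L)) L (IsCMField.complexConj L) 3 (Matrix.diagonal α)))
        (x : ↥(UnitaryGroup.arch (↥(maximalRealSubfield L)) L (IsCMField.complexConj L) 2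
            (Matrix.of fun i j : Fin 2 => if i.val + j.val + 1 = 2 then (1 : L) else 0)) ×
          ↥(UnitaryGroup.arch (↥(maximalRealSubfield L)) L (IsCMField.complexConj L) 1
            (Matrix.of fun i j : Fin 1 => if i.val + j.val + 1 = 1 then (1 : L) else 0))),
        archExplicitDelta L (Matrix.diagonal α) (x * a * x⁻¹) μ b = archExplicitDelta L (Matrix.diagonal α) a μ b)
    (hr : ∀ (a : ↥(UnitaryGroup.arch (↥(maximalRealSubfield L)) L (IsCMField.complexConj L) 2
            (Matrix.of fun i j : Fin 2 => if i.val + j.val + 1 = 2 then (1 : L) else 0)) ×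
          ↥(UnitaryGroup.arch (↥(maximalRealSubfield L)) L (IsCMField.complexConj L) 1
            (Matrix.of fun i j : Fin 1 => if i.val + j.val + 1 = 1 then (1 : L) else 0)))
        (b y : ↥(UnitaryGroup.arch (↥(maximalRealSubfield L)) L (IsCMField.complexConj L) 3 (Matrix.diagonal α))),
        archExplicitDelta L (Matrix.diagonal α) a μ (y * b * y⁻¹) = archExplicitDelta L (Matrix.diagonal α) a μ b)
    {a' : ↥(UnitaryGroup.arch (↥(maximalRealSubfield L)) L (IsCMField.complexConj L) 3 (Matrix.diagonal α)) → ℂ} (ha' : ArchSmooth L 3 (Matrix.diagonal α) a')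
    (ζ : {w : InfinitePlace L // IsComplex w} → Fin 3 → Circle) :
    ContDiff ℝ ∞ fun θ : {w : InfinitePlace L // IsComplex w} → Fin 3 → ℝ =>
      ∑ᶠ c' : ConjClasses ↥(UnitaryGroup.arch (↥(maximalRealSubfield L)) L (IsCMField.complexConj L) 3 (Matrix.diagonal α)),
        (archExplicitTransferFactor L (Matrix.diagonal α) μ hl hr).Δ (γH fun w i => ζ w i * Circle.exp (θ w i)) (Quotient.out c') *
          ∫ g : ↥(UnitaryGroup.arch (↥(maximalRealSubfield L)) L (IsCMField.complexConj L) 3 (Matrix.diagonal α)), a' (g * Quotient.out c' * g⁻¹) ∂ν' := by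
  obtain ⟨Θ, hΘ, -, -, haΘ⟩ := ha'.exists_contDiff
  have hfun : (fun θ : {w : InfinitePlace L // IsComplex w} → Fin 3 → ℝ =>
      ∑ᶠ c' : ConjClasses ↥(UnitaryGroup.arch (↥(maximalRealSubfield L)) L (IsCMField.complexConj L) 3 (Matrix.diagonal α)),
        (archExplicitTransferFactor L (Matrix.diagonal α) μ hl hr).Δ (γH fun w i => ζ w i * Circle.exp (θ w i)) (Quotient.out c') *
          ∫ g : ↥(UnitaryGroup.arch (↥(maximalRealSubfield L)) L (IsCMField.complexConj L) 3 (Matrix.diagonal α)), a' (g * Quotient.out c' * g⁻¹) ∂ν') =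
      fun θ => ∑ᶠ c' : ConjClasses ↥(UnitaryGroup.arch (↥(maximalRealSubfield L)) L (IsCMField.complexConj L) 3 (Matrix.diagonal α)),
        (archExplicitTransferFactor L (Matrix.diagonal α) μ hl hr).Δ (γH fun w i => ζ w i * Circle.exp (θ w i)) (Quotient.out c') *
          ∫ g : ↥(UnitaryGroup.arch (↥(maximalRealSubfield L)) L (IsCMField.complexConj L) 3 (Matrix.diagonal α)),
            Θ ((((g * Quotient.out c' * g⁻¹ : ↥(UnitaryGroup.arch (↥(maximalRealSubfield L)) L (IsCMField.complexConj L) 3 (Matrix.diagonal α))) :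
              GL (Fin 3) (mixedSpace L)) : Matrix (Fin 3) (Fin 3) (mixedSpace L))) ∂ν' := by
    funext θ
    refine finsum_congr fun c' => ?_
    congr 1
    exact integral_congr_ae (Eventually.of_forall fun g => haΘ _)
  rw [hfun]
  exact contDiff_finsum_archExplicitDelta_mul_integral_angles_of_sameSign L α γH hγH ν' hα hherm hsame μ hμω hl hr Θ hΘ ζ

end Definite

end Literature.NumberTheory.Rogawski1990

end
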